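import Literature.NumberTheory.Automorphic.UnitaryTwoEulerPoincareEllipticTypeTwoDischarged   -- ★ B-p08: type-(2) relation `V_C + V_C′ = E + 1` on `U₂`, `typeTwo_sideConditions_of_not_exists_isRoot`; brings ★ `Rogawski1990.UnitaryTwoTypeTwoEdgeCount` (`natCard_fixedBy_glInt_eq_sum_of_unitary`, `natCard_fixedBy_iwahori_add_one_eq_two_mul_sum_of_not_exists_isRoot`), ★ `natCard_fixedBy_quotient_congr`
import Literature.NumberTheory.Automorphic.LocalUnitaryIntegralLevel                           -- ★ `mem_localIntegralLevel_iff_of_smul_eq` (`K₂ ↔ GL₂(𝒪_w)` at the non-split `w`)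
import Summits.HodgeConjecture.HodgeConjecture.Theorems.K2E3RankOneEllipticFixedPointCount             -- ★ p855695 (this seat, rung 1): `two_le_natCard_residue` (reused, not restated)
import HarnessLib

/-!
# K2 ∕ E3 «EllipticInputs», sub-line «U3b-c RANK-ONE GERMS», leaf (S♭) `sig_K2E3CentralGermConstant`, rung 2 — `K2E3RankOneEllipticFixedPointCountQuadratic`:
# the `δ`-fixed vertices of the tree of `U(Φ₂)(L⁺_v)` for the OTHER elliptic tori at an unramified non-split `v` (type (2): `χ_δ` rootless over `L_w`) form the EDGE-centred
# ball of radius `N + ½`, `|tr² − 4det|_w = q_w^{−(2N+1)}`: `#Fix_δ(U₂ ⧸ K₂) = Σ_{k ≤ N} q_v^k = (q_v^{N+1} − 1)∕(q_v − 1)` per colour, `2(q_v^{N+1} − 1)∕(q_v − 1)` in all —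
# CLOSED FORMS with constant terms `−1∕(q−1)` per colour, `−2∕(q−1)` in all

Cell `hodgecm-mathlib` (Track B «K2-LIT»), engine E3, crux H413 = `stmt-HodgeConjecture-24833`; dealt BY NAME by the line lead (ii′) K2E4-p06 (g2) 2026-09-03T23:35:09Z (recorded
by K2E3-plan (g1)) to the free E5 hand K2E5-p11 (g2), sequel of ★ p855695 `K2E3RankOneEllipticFixedPointCount` (type (1)).  PROOF lane, THEOREMS ONLY (no `def`, no `instance`,
no `notation`, no named-fact hypothesis, no `sorry`); `--supports stmt-HodgeConjecture-24833 --as helper` (count-neutral).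

★ CENSUS (a thin closed-form layer; nothing is re-proved).  `v` a finite place of `L⁺` NON-SPLIT (`c • w = w`) and UNRAMIFIED in the CM field `L`, `U₂ = (cmDatum L 2 Φ₂).Local v`,
`δ_w := localNonsplitEquiv … δ ∈ U(σ_w, (Φ₂)_w) ≤ GL₂(L_w)`.  TYPE (2) = «`χ_{δ,w}` has no root in `L_w`»: the eigenvalue field is `M = L_w · M′` with `M′ ∕ L⁺_v` a RAMIFIED
quadratic extension (the unramified one is `L_w` itself = type (1)), so `M ∕ L_w` is ramified, the discriminant depth is ODD (`|tr² − 4det|_w = exp(−(2N+1))`, ★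
`exists_valued_disc_eq_exp_neg_odd_of_not_exists_isRoot`) and `δ` fixes the EDGE-centred ball of radius `N + ½` of the `(q_v+1)`-regular tree [Kottwitz1988, §2]: ★ B-p08
`natCard_fixedBy_glInt_eq_sum_of_unitary` (`#Fix_{δ_w}(U_w ⧸ K_U) = Σ_{k ≤ N} q_v^k`), ★ `natCard_fixedBy_iwahori_add_one_eq_two_mul_sum_of_not_exists_isRoot` (edges `E + 1 = 2Σ`), ★
`UnitaryTwoEulerPoincareEllipticTypeTwo.natCard_fixedBy_add_eq_natCard_fixedBy_add_one_of_not_exists_isRoot` (`V_C + V_{C′} = E + 1` on `U₂`), ★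
`typeTwo_sideConditions_of_not_exists_isRoot` (`hirr` + `2 ∈ 𝒪_wˣ` ⇒ `|2|_w = 1`, `tr δ_w ∈ 𝒪_w`, `∃ N`), binders `|2|_w = 1` (non-dyadic) as in ★.
THIS FILE ADDS: §1 the closed forms `(q − 1)·Σ_{k ≤ N} q^k + 1 = q^{N+1}`, `Σ = (q^{N+1} − 1)∕(q − 1) = −1∕(q−1) + (q∕(q−1))·q^N`, `2Σ = 2(q^{N+1} − 1)∕(q − 1)`; §2 the count on the
CM carrier for the CONCRETE hyperspecial `K₂ = cmLocalIntegralLevel L 2 Φ₂ v` (the reading of `Φ(δ, 1_{K₂})`): `#Fix_δ(U₂ ⧸ K₂) = Σ_{k ≤ N} q_v^k`, its closed form, and the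
`hirr`-only form; §3 ALL fixed vertices `#Fix(U₂ ⧸ C) + #Fix(U₂ ⧸ C′) = 2Σ_{k ≤ N} q_v^k` for the two hyperspecials of ★ (R5c′) (abstract `C, C′, I` characterised at `w`).
HONEST LABEL: HC_CM is proved only modulo the 7 printed citations (2 remaining named inputs: hLiu418 = stmt-HodgeConjecture-24832, h413 = stmt-HodgeConjecture-24833) until rung 0
closes; count-neutral helper (one input of (S♭); dyadic `v`, ramified `v` and the germ uniqueness are not touched).

## References
* [Kottwitz1988] R. E. Kottwitz, *Tamagawa numbers*, Ann. of Math. 127 (1988), §2 Theorem 2 (fixed points of an elliptic element: a ball about a vertex or an edge midpoint).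
* [LabesseLanglands1979] J.-P. Labesse, R. P. Langlands, *L-indistinguishability for SL(2)*, Canad. J. Math. 31 (1979), §2 p. 8 (`δ_m = 2q^m` for a ramified torus).
* [Rogawski1990] J. D. Rogawski, *Automorphic Representations of Unitary Groups in Three Variables* (1990), §3.6 p. 31 (the tori `(EK)¹`), §8.1 p. 117 (constant germ), §12.6 p. 174.
* [Serre1980Trees] J.-P. Serre, *Trees* (1980), Ch. II §1.1 (the `(q+1)`-regular tree; edge-centred balls).
-/

set_option autoImplicit false
-- the mandated namespace repeats the single-problem summit's segment (`HodgeConjecture.HodgeConjecture`)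
set_option linter.dupNamespace false

noncomputable section

namespace Summit.HodgeConjecture.HodgeConjecture.Cruxes.H413.K2E3RankOneEllipticFixedPointCountQuadratic

open Finset NumberField IsDedekindDomain Matrix ValuativeRel MulAction
open scoped ValuativeRel Matrix MatrixGroups
open Literature.NumberTheory.Automorphic Literature.NumberTheory.Automorphic.UnitaryGroup
open Literature.NumberTheory.Rogawski1990 Literature.NumberTheory.GaloisRepresentations

/-! ## §1 Closed forms of `Σ_{k ≤ N} q^k` (one colour of the edge-centred ball of radius `N + ½`) -/

section Arithmetic

/-- **`(q − 1) · Σ_{k ≤ N} q^k + 1 = q^{N+1}`** (`1 ≤ q`): one colour of the edge-centred ball of radius `N + ½` in the `(q+1)`-regular tree has `1 + q + ⋯ + q^N`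
vertices. [cite: Serre1980Trees, Ch. II §1.1] [cite: LabesseLanglands1979, §2 p. 8] -/
theorem pred_mul_sum_pow_add_one {q : ℕ} (hq : 1 ≤ q) (N : ℕ) : (q - 1) * (∑ k ∈ range (N + 1), q ^ k) + 1 = q ^ (N + 1) := by
  obtain ⟨d, rfl⟩ := Nat.exists_eq_add_of_le' hq
  rw [Nat.add_sub_cancel]
  induction N with
  | zero => simp
  | succ N ih =>
    rw [Finset.sum_range_succ, mul_add, add_right_comm, ih]
    ring

/-- **The per-colour count in `ℚ`**: `Σ_{k ≤ N} q^k = (q^{N+1} − 1)∕(q − 1)` (`2 ≤ q`). [cite: Serre1980Trees, Ch. II §1.1] -/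
theorem cast_sum_pow_eq_div {q : ℕ} (hq : 2 ≤ q) (N : ℕ) :
    (((∑ k ∈ range (N + 1), q ^ k : ℕ)) : ℚ) = ((q : ℚ) ^ (N + 1) - 1) / ((q : ℚ) - 1) := by
  have hq1 : ((q : ℚ) - 1) ≠ 0 := by
    have : (2 : ℚ) ≤ q := by exact_mod_cast hq
    linarith
  have h1 : 1 ≤ q := le_trans (by norm_num) hq
  have h' := congrArg (fun n : ℕ => (n : ℚ)) (pred_mul_sum_pow_add_one h1 N)
  simp only [Nat.cast_add, Nat.cast_mul, Nat.cast_sub h1, Nat.cast_one, Nat.cast_pow] at h'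
  rw [eq_div_iff hq1]
  linarith

/-- **The germ reading**: `Σ_{k ≤ N} q^k = −1∕(q − 1) + (q∕(q − 1)) · q^N` (`2 ≤ q`) — a NEGATIVE constant plus a multiple of `q^N`. [cite: Rogawski1990, §8.1 p. 117]
[cite: Kottwitz1988, §2] -/
theorem cast_sum_pow_eq_neg_inv_add {q : ℕ} (hq : 2 ≤ q) (N : ℕ) :
    (((∑ k ∈ range (N + 1), q ^ k : ℕ)) : ℚ) = -(1 / ((q : ℚ) - 1)) + ((q : ℚ) / ((q : ℚ) - 1)) * (q : ℚ) ^ N := by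
  have hq1 : ((q : ℚ) - 1) ≠ 0 := by
    have : (2 : ℚ) ≤ q := by exact_mod_cast hq
    linarith
  rw [cast_sum_pow_eq_div hq N, pow_succ]
  field_simp
  ring

/-- **Both colours**: `2 · Σ_{k ≤ N} q^k = 2(q^{N+1} − 1)∕(q − 1)` (`2 ≤ q`) — ALL vertices of the edge-centred ball of radius `N + ½` (constant term `−2∕(q−1)`).
[cite: LabesseLanglands1979, §2 p. 8] [cite: Serre1980Trees, Ch. II §1.1] -/
theorem cast_two_mul_sum_pow_eq {q : ℕ} (hq : 2 ≤ q) (N : ℕ) :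
    (((2 * ∑ k ∈ range (N + 1), q ^ k : ℕ)) : ℚ) = 2 * ((q : ℚ) ^ (N + 1) - 1) / ((q : ℚ) - 1) := by
  rw [Nat.cast_mul, cast_sum_pow_eq_div hq N, Nat.cast_ofNat, mul_div_assoc]

end Arithmetic

section CM

variable (L : Type) [Field L] [NumberField L] [IsCMField L] (v : HeightOneSpectrum (𝓞 ↥(maximalRealSubfield L)))
  (w : PlacesOver L v) (hw : IsCMField.complexConj L • w.1 = w.1)

/-! ## §2 The count on the CM carrier for the hyperspecial `K₂ = U(Φ₂)(𝒪_v)` -/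

include hw in
/-- **`#Fix_δ(U₂ ⧸ K₂) = Σ_{k ≤ N} q_v^k`** for a TYPE-(2) elliptic `δ ∈ U₂ = U(Φ₂)(L⁺_v)` at a non-split unramified `v` (`χ_{δ,w}` rootless over `L_w`, `tr δ_w ∈ 𝒪_w`, `|2|_w = 1`,
`|tr² − 4det|_w = exp(−(2N+1))`): ★ B-p08 `natCard_fixedBy_glInt_eq_sum_of_unitary` at `δ_w`, transported to the CONCRETE hyperspecial `K₂ = cmLocalIntegralLevel` of the CM carrier
(★ `natCard_fixedBy_quotient_congr`, ★ `mem_localIntegralLevel_iff_of_smul_eq`). [cite: Kottwitz1988, §2 Theorem 2] [cite: Rogawski1990, §3.6 p. 31; §12.6 p. 174] -/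
theorem natCard_fixedBy_cmLocalIntegralLevel_two_eq_sum_pow_of_not_exists_isRoot (hunr : Algebra.IsUnramifiedIn (𝓞 L) v.asIdeal)
    (γ : ((cmDatum L 2 (Matrix.of fun i j : Fin 2 => if i.val + j.val + 1 = 2 then (1 : L) else 0)).Local v))
    (h2v : valuation (w.1.adicCompletion L) 2 = 1) (ht : ((((((localNonsplitEquiv (IsCMField.complexConj L) (Matrix.of fun i j : Fin 2 => if i.val + j.val + 1 = 2 then (1 : L) else 0) (IsCMField.complexConj_ne_one L) w hw) γ : ↥(unitaryGroupOfForm (galAdicCompletionMap (L := L) (IsCMField.complexConj L) hw) (placeForm (Matrix.of fun i j : Fin 2 => if i.val + j.val + 1 = 2 then (1 : L) else 0) w.1)))) : GL (Fin 2) (w.1.adicCompletion L)) : Matrix (Fin 2) (Fin 2) (w.1.adicCompletion L))).trace ∈ 𝒪[(w.1.adicCompletion L)])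
    (hirr : ¬ ∃ x : (w.1.adicCompletion L), (((((((localNonsplitEquiv (IsCMField.complexConj L) (Matrix.of fun i j : Fin 2 => if i.val + j.val + 1 = 2 then (1 : L) else 0) (IsCMField.complexConj_ne_one L) w hw) γ : ↥(unitaryGroupOfForm (galAdicCompletionMap (L := L) (IsCMField.complexConj L) hw) (placeForm (Matrix.of fun i j : Fin 2 => if i.val + j.val + 1 = 2 then (1 : L) else 0) w.1)))) : GL (Fin 2) (w.1.adicCompletion L)) : Matrix (Fin 2) (Fin 2) (w.1.adicCompletion L))).charpoly).IsRoot x)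
    (N : ℕ) (hN : Valued.v (((((((localNonsplitEquiv (IsCMField.complexConj L) (Matrix.of fun i j : Fin 2 => if i.val + j.val + 1 = 2 then (1 : L) else 0) (IsCMField.complexConj_ne_one L) w hw) γ : ↥(unitaryGroupOfForm (galAdicCompletionMap (L := L) (IsCMField.complexConj L) hw) (placeForm (Matrix.of fun i j : Fin 2 => if i.val + j.val + 1 = 2 then (1 : L) else 0) w.1)))) : GL (Fin 2) (w.1.adicCompletion L)) : Matrix (Fin 2) (Fin 2) (w.1.adicCompletion L))).trace ^ 2 - 4 * ((((((localNonsplitEquiv (IsCMField.complexConj L) (Matrix.of fun i j : Fin 2 => if i.val + j.val + 1 = 2 then (1 : L) else 0) (IsCMField.complexConj_ne_one L) w hw) γ : ↥(unitaryGroupOfForm (galAdicCompletionMap (L := L) (IsCMField.complexConj L) hw) (placeForm (Matrix.of fun i j : Fin 2 => if i.val + j.val + 1 = 2 then (1 : L) else 0) w.1)))) : GL (Fin 2) (w.1.adicCompletion L)) : Matrix (Fin 2) (Fin 2) (w.1.adicCompletion L))).det) = WithZero.exp (-((2 * N + 1 : ℕ) : ℤ))) :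
    Nat.card (MulAction.fixedBy (((cmDatum L 2 (Matrix.of fun i j : Fin 2 => if i.val + j.val + 1 = 2 then (1 : L) else 0)).Local v) ⧸ cmLocalIntegralLevel L 2 (Matrix.of fun i j : Fin 2 => if i.val + j.val + 1 = 2 then (1 : L) else 0) v) γ) = ∑ k ∈ range (N + 1), Nat.card (𝓞 ↥(maximalRealSubfield L) ⧸ v.asIdeal) ^ k := by
  have hc1 : IsCMField.complexConj L ≠ 1 := IsCMField.complexConj_ne_one L
  have hK : ∀ g : ((cmDatum L 2 (Matrix.of fun i j : Fin 2 => if i.val + j.val + 1 = 2 then (1 : L) else 0)).Local v), g ∈ cmLocalIntegralLevel L 2 (Matrix.of fun i j : Fin 2 => if i.val + j.val + 1 = 2 then (1 : L) else 0) v ↔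
      ((localNonsplitEquiv (IsCMField.complexConj L) (Matrix.of fun i j : Fin 2 => if i.val + j.val + 1 = 2 then (1 : L) else 0) (IsCMField.complexConj_ne_one L) w hw) g : ↥(unitaryGroupOfForm (galAdicCompletionMap (L := L) (IsCMField.complexConj L) hw) (placeForm (Matrix.of fun i j : Fin 2 => if i.val + j.val + 1 = 2 then (1 : L) else 0) w.1))) ∈
        (glInt 2 (w.1.adicCompletion L)).subgroupOf (unitaryGroupOfForm (galAdicCompletionMap (L := L) (IsCMField.complexConj L) hw) (placeForm (Matrix.of fun i j : Fin 2 => if i.val + j.val + 1 = 2 then (1 : L) else 0) w.1)) :=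
    fun g => (mem_localIntegralLevel_iff_of_smul_eq (IsCMField.complexConj L) 2 (Matrix.of fun i j : Fin 2 => if i.val + j.val + 1 = 2 then (1 : L) else 0) hc1 w hw g).trans Subgroup.mem_subgroupOf.symm
  rw [natCard_fixedBy_quotient_congr (cmLocalIntegralLevel L 2 (Matrix.of fun i j : Fin 2 => if i.val + j.val + 1 = 2 then (1 : L) else 0) v) _ (localNonsplitEquiv (IsCMField.complexConj L) (Matrix.of fun i j : Fin 2 => if i.val + j.val + 1 = 2 then (1 : L) else 0) (IsCMField.complexConj_ne_one L) w hw).toMulEquiv hK γ]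
  exact natCard_fixedBy_glInt_eq_sum_of_unitary L v w hw hunr ((localNonsplitEquiv (IsCMField.complexConj L) (Matrix.of fun i j : Fin 2 => if i.val + j.val + 1 = 2 then (1 : L) else 0) (IsCMField.complexConj_ne_one L) w hw) γ) h2v ht hirr N hN

include hw in
/-- **CLOSED FORM: `(q_v − 1) · #Fix_δ(U₂ ⧸ K₂) + 1 = q_v^{N+1}`** for a type-(2) elliptic `δ` as above — `Φ(δ, 1_{K₂}) = #Fix_δ(U₂ ⧸ K₂)·ν(K₂)` (★ `UnitOrbitalIntegralFixedPointsVolume`)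
is `ν(K₂)(q^{N+1} − 1)∕(q − 1) = ν(K₂)(−1∕(q−1) + (q∕(q−1))·q^N)`: constant term `−ν(K₂)∕(q_v − 1) < 0`, the same as for type (1) (★ p855695).
[cite: Kottwitz1988, §2 Theorem 2] [cite: Rogawski1990, §8.1 p. 117] -/
theorem pred_mul_natCard_fixedBy_cmLocalIntegralLevel_two_add_one_eq_pow (hunr : Algebra.IsUnramifiedIn (𝓞 L) v.asIdeal)
    (γ : ((cmDatum L 2 (Matrix.of fun i j : Fin 2 => if i.val + j.val + 1 = 2 then (1 : L) else 0)).Local v))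
    (h2v : valuation (w.1.adicCompletion L) 2 = 1) (ht : ((((((localNonsplitEquiv (IsCMField.complexConj L) (Matrix.of fun i j : Fin 2 => if i.val + j.val + 1 = 2 then (1 : L) else 0) (IsCMField.complexConj_ne_one L) w hw) γ : ↥(unitaryGroupOfForm (galAdicCompletionMap (L := L) (IsCMField.complexConj L) hw) (placeForm (Matrix.of fun i j : Fin 2 => if i.val + j.val + 1 = 2 then (1 : L) else 0) w.1)))) : GL (Fin 2) (w.1.adicCompletion L)) : Matrix (Fin 2) (Fin 2) (w.1.adicCompletion L))).trace ∈ 𝒪[(w.1.adicCompletion L)])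
    (hirr : ¬ ∃ x : (w.1.adicCompletion L), (((((((localNonsplitEquiv (IsCMField.complexConj L) (Matrix.of fun i j : Fin 2 => if i.val + j.val + 1 = 2 then (1 : L) else 0) (IsCMField.complexConj_ne_one L) w hw) γ : ↥(unitaryGroupOfForm (galAdicCompletionMap (L := L) (IsCMField.complexConj L) hw) (placeForm (Matrix.of fun i j : Fin 2 => if i.val + j.val + 1 = 2 then (1 : L) else 0) w.1)))) : GL (Fin 2) (w.1.adicCompletion L)) : Matrix (Fin 2) (Fin 2) (w.1.adicCompletion L))).charpoly).IsRoot x)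
    (N : ℕ) (hN : Valued.v (((((((localNonsplitEquiv (IsCMField.complexConj L) (Matrix.of fun i j : Fin 2 => if i.val + j.val + 1 = 2 then (1 : L) else 0) (IsCMField.complexConj_ne_one L) w hw) γ : ↥(unitaryGroupOfForm (galAdicCompletionMap (L := L) (IsCMField.complexConj L) hw) (placeForm (Matrix.of fun i j : Fin 2 => if i.val + j.val + 1 = 2 then (1 : L) else 0) w.1)))) : GL (Fin 2) (w.1.adicCompletion L)) : Matrix (Fin 2) (Fin 2) (w.1.adicCompletion L))).trace ^ 2 - 4 * ((((((localNonsplitEquiv (IsCMField.complexConj L) (Matrix.of fun i j : Fin 2 => if i.val + j.val + 1 = 2 then (1 : L) else 0) (IsCMField.complexConj_ne_one L) w hw) γ : ↥(unitaryGroupOfForm (galAdicCompletionMap (L := L) (IsCMField.complexConj L) hw) (placeForm (Matrix.of fun i j : Fin 2 => if i.val + j.val + 1 = 2 then (1 : L) else 0) w.1)))) : GL (Fin 2) (w.1.adicCompletion L)) : Matrix (Fin 2) (Fin 2) (w.1.adicCompletion L))).det) = WithZero.exp (-((2 * N + 1 : ℕ) : ℤ))) :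
    (Nat.card (𝓞 ↥(maximalRealSubfield L) ⧸ v.asIdeal) - 1) * Nat.card (MulAction.fixedBy (((cmDatum L 2 (Matrix.of fun i j : Fin 2 => if i.val + j.val + 1 = 2 then (1 : L) else 0)).Local v) ⧸ cmLocalIntegralLevel L 2 (Matrix.of fun i j : Fin 2 => if i.val + j.val + 1 = 2 then (1 : L) else 0) v) γ) + 1 = Nat.card (𝓞 ↥(maximalRealSubfield L) ⧸ v.asIdeal) ^ (N + 1) := by
  rw [natCard_fixedBy_cmLocalIntegralLevel_two_eq_sum_pow_of_not_exists_isRoot L v w hw hunr γ h2v ht hirr N hN]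
  exact pred_mul_sum_pow_add_one (le_trans (by norm_num) (K2E3RankOneEllipticFixedPointCount.two_le_natCard_residue L v)) N

include hw in
/-- **THE `hirr`-ONLY FORM**: at `v` non-split and unramified in `L` with `2 ∈ 𝒪_wˣ`, for `δ ∈ U₂` with `χ_{δ,w}` ROOTLESS over `L_w` there is `N` (`|tr² − 4det|_w = exp(−(2N+1))`,
★ `typeTwo_sideConditions_of_not_exists_isRoot`) with `#Fix_δ(U₂ ⧸ K₂) = Σ_{k ≤ N} q_v^k` and `(q_v − 1)·#Fix + 1 = q_v^{N+1}`. [cite: Kottwitz1988, §2 Theorem 2] [cite: Rogawski1990, §3.6 p. 31] -/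
theorem exists_natCard_fixedBy_cmLocalIntegralLevel_two_eq_sum_pow_of_not_exists_isRoot (hunr : Algebra.IsUnramifiedIn (𝓞 L) v.asIdeal)
    (h2 : IsUnit (2 : 𝒪[(w.1.adicCompletion L)])) (γ : ((cmDatum L 2 (Matrix.of fun i j : Fin 2 => if i.val + j.val + 1 = 2 then (1 : L) else 0)).Local v))
    (hirr : ¬ ∃ x : (w.1.adicCompletion L), (((((((localNonsplitEquiv (IsCMField.complexConj L) (Matrix.of fun i j : Fin 2 => if i.val + j.val + 1 = 2 then (1 : L) else 0) (IsCMField.complexConj_ne_one L) w hw) γ : ↥(unitaryGroupOfForm (galAdicCompletionMap (L := L) (IsCMField.complexConj L) hw) (placeForm (Matrix.of fun i j : Fin 2 => if i.val + j.val + 1 = 2 then (1 : L) else 0) w.1)))) : GL (Fin 2) (w.1.adicCompletion L)) : Matrix (Fin 2) (Fin 2) (w.1.adicCompletion L))).charpoly).IsRoot x) :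
    ∃ N : ℕ, Valued.v (((((((localNonsplitEquiv (IsCMField.complexConj L) (Matrix.of fun i j : Fin 2 => if i.val + j.val + 1 = 2 then (1 : L) else 0) (IsCMField.complexConj_ne_one L) w hw) γ : ↥(unitaryGroupOfForm (galAdicCompletionMap (L := L) (IsCMField.complexConj L) hw) (placeForm (Matrix.of fun i j : Fin 2 => if i.val + j.val + 1 = 2 then (1 : L) else 0) w.1)))) : GL (Fin 2) (w.1.adicCompletion L)) : Matrix (Fin 2) (Fin 2) (w.1.adicCompletion L))).trace ^ 2 - 4 * ((((((localNonsplitEquiv (IsCMField.complexConj L) (Matrix.of fun i j : Fin 2 => if i.val + j.val + 1 = 2 then (1 : L) else 0) (IsCMField.complexConj_ne_one L) w hw) γ : ↥(unitaryGroupOfForm (galAdicCompletionMap (L := L) (IsCMField.complexConj L) hw) (placeForm (Matrix.of fun i j : Fin 2 => if i.val + j.val + 1 = 2 then (1 : L) else 0) w.1)))) : GL (Fin 2) (w.1.adicCompletion L)) : Matrix (Fin 2) (Fin 2) (w.1.adicCompletion L))).det) = WithZero.exp (-((2 * N + 1 : ℕ) : ℤ)) ∧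
      Nat.card (MulAction.fixedBy (((cmDatum L 2 (Matrix.of fun i j : Fin 2 => if i.val + j.val + 1 = 2 then (1 : L) else 0)).Local v) ⧸ cmLocalIntegralLevel L 2 (Matrix.of fun i j : Fin 2 => if i.val + j.val + 1 = 2 then (1 : L) else 0) v) γ) = ∑ k ∈ range (N + 1), Nat.card (𝓞 ↥(maximalRealSubfield L) ⧸ v.asIdeal) ^ k ∧
      (Nat.card (𝓞 ↥(maximalRealSubfield L) ⧸ v.asIdeal) - 1) * Nat.card (MulAction.fixedBy (((cmDatum L 2 (Matrix.of fun i j : Fin 2 => if i.val + j.val + 1 = 2 then (1 : L) else 0)).Local v) ⧸ cmLocalIntegralLevel L 2 (Matrix.of fun i j : Fin 2 => if i.val + j.val + 1 = 2 then (1 : L) else 0) v) γ) + 1 = Nat.card (𝓞 ↥(maximalRealSubfield L) ⧸ v.asIdeal) ^ (N + 1) := by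
  obtain ⟨h2v, ht, N, hN⟩ := typeTwo_sideConditions_of_not_exists_isRoot L v w hw hunr h2 γ hirr
  exact ⟨N, hN, natCard_fixedBy_cmLocalIntegralLevel_two_eq_sum_pow_of_not_exists_isRoot L v w hw hunr γ h2v ht hirr N hN,
    pred_mul_natCard_fixedBy_cmLocalIntegralLevel_two_add_one_eq_pow L v w hw hunr γ h2v ht hirr N hN⟩

/-! ## §3 All fixed vertices: both hyperspecials of ★ (R5c′) -/

include hw in
/-- **ALL `δ`-FIXED VERTICES: `#Fix(U₂ ⧸ C) + #Fix(U₂ ⧸ C′) = 2 · Σ_{k ≤ N} q_v^k`** — the EDGE-centred ball of radius `N + ½`, `2(q_v^{N+1} − 1)∕(q_v − 1)` vertices — for the two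
hyperspecials `C ↔ GL₂(𝒪_w)`, `C′ ↔ d GL₂(𝒪_w) d⁻¹` (`d = diag(1, ϖ)`, `σ_w ϖ = ϖ`) and the Iwahori `I` of ★ (R5c′), and a type-(2) elliptic `δ` as in §2: ★ relation
`V_C + V_{C′} = E + 1` with ★ edge count `E + 1 = 2Σ`. [cite: Kottwitz1988, §2 Theorem 2] [cite: LabesseLanglands1979, §2 p. 8] [cite: Serre1980Trees, Ch. II §1.1] -/
theorem natCard_fixedBy_add_natCard_fixedBy_eq_two_mul_sum_pow (hunr : Algebra.IsUnramifiedIn (𝓞 L) v.asIdeal)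
    (ϖ : (w.1.adicCompletion L)ˣ)
    (hσϖ : (galAdicCompletionMap (L := L) (IsCMField.complexConj L) hw) (ϖ : (w.1.adicCompletion L)) = ϖ)
    (C C' I : Subgroup ((cmDatum L 2 (Matrix.of fun i j : Fin 2 => if i.val + j.val + 1 = 2 then (1 : L) else 0)).Local v))
    (hC : ∀ g, g ∈ C ↔ (((localNonsplitEquiv (IsCMField.complexConj L) (Matrix.of fun i j : Fin 2 => if i.val + j.val + 1 = 2 then (1 : L) else 0) (IsCMField.complexConj_ne_one L) w hw) g : ↥(unitaryGroupOfForm (galAdicCompletionMap (L := L) (IsCMField.complexConj L) hw) (placeForm (Matrix.of fun i j : Fin 2 => if i.val + j.val + 1 = 2 then (1 : L) else 0) w.1))) : GL (Fin 2) (w.1.adicCompletion L)) ∈ glInt 2 (w.1.adicCompletion L))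
    (hC' : ∀ g, g ∈ C' ↔ (((localNonsplitEquiv (IsCMField.complexConj L) (Matrix.of fun i j : Fin 2 => if i.val + j.val + 1 = 2 then (1 : L) else 0) (IsCMField.complexConj_ne_one L) w hw) g : ↥(unitaryGroupOfForm (galAdicCompletionMap (L := L) (IsCMField.complexConj L) hw) (placeForm (Matrix.of fun i j : Fin 2 => if i.val + j.val + 1 = 2 then (1 : L) else 0) w.1))) : GL (Fin 2) (w.1.adicCompletion L)) ∈ (glInt 2 (w.1.adicCompletion L)).map (MulAut.conj (glDiagonal 2 (w.1.adicCompletion L) ![1, ϖ])).toMonoidHom)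
    (hI : ∀ g, g ∈ I ↔ (((localNonsplitEquiv (IsCMField.complexConj L) (Matrix.of fun i j : Fin 2 => if i.val + j.val + 1 = 2 then (1 : L) else 0) (IsCMField.complexConj_ne_one L) w hw) g : ↥(unitaryGroupOfForm (galAdicCompletionMap (L := L) (IsCMField.complexConj L) hw) (placeForm (Matrix.of fun i j : Fin 2 => if i.val + j.val + 1 = 2 then (1 : L) else 0) w.1))) : GL (Fin 2) (w.1.adicCompletion L)) ∈ iwahoriGL 2 (w.1.adicCompletion L))
    (γ : ((cmDatum L 2 (Matrix.of fun i j : Fin 2 => if i.val + j.val + 1 = 2 then (1 : L) else 0)).Local v))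
    (h2v : valuation (w.1.adicCompletion L) 2 = 1) (ht : ((((((localNonsplitEquiv (IsCMField.complexConj L) (Matrix.of fun i j : Fin 2 => if i.val + j.val + 1 = 2 then (1 : L) else 0) (IsCMField.complexConj_ne_one L) w hw) γ : ↥(unitaryGroupOfForm (galAdicCompletionMap (L := L) (IsCMField.complexConj L) hw) (placeForm (Matrix.of fun i j : Fin 2 => if i.val + j.val + 1 = 2 then (1 : L) else 0) w.1)))) : GL (Fin 2) (w.1.adicCompletion L)) : Matrix (Fin 2) (Fin 2) (w.1.adicCompletion L))).trace ∈ 𝒪[(w.1.adicCompletion L)])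
    (hirr : ¬ ∃ x : (w.1.adicCompletion L), (((((((localNonsplitEquiv (IsCMField.complexConj L) (Matrix.of fun i j : Fin 2 => if i.val + j.val + 1 = 2 then (1 : L) else 0) (IsCMField.complexConj_ne_one L) w hw) γ : ↥(unitaryGroupOfForm (galAdicCompletionMap (L := L) (IsCMField.complexConj L) hw) (placeForm (Matrix.of fun i j : Fin 2 => if i.val + j.val + 1 = 2 then (1 : L) else 0) w.1)))) : GL (Fin 2) (w.1.adicCompletion L)) : Matrix (Fin 2) (Fin 2) (w.1.adicCompletion L))).charpoly).IsRoot x)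
    (N : ℕ) (hN : Valued.v (((((((localNonsplitEquiv (IsCMField.complexConj L) (Matrix.of fun i j : Fin 2 => if i.val + j.val + 1 = 2 then (1 : L) else 0) (IsCMField.complexConj_ne_one L) w hw) γ : ↥(unitaryGroupOfForm (galAdicCompletionMap (L := L) (IsCMField.complexConj L) hw) (placeForm (Matrix.of fun i j : Fin 2 => if i.val + j.val + 1 = 2 then (1 : L) else 0) w.1)))) : GL (Fin 2) (w.1.adicCompletion L)) : Matrix (Fin 2) (Fin 2) (w.1.adicCompletion L))).trace ^ 2 - 4 * ((((((localNonsplitEquiv (IsCMField.complexConj L) (Matrix.of fun i j : Fin 2 => if i.val + j.val + 1 = 2 then (1 : L) else 0) (IsCMField.complexConj_ne_one L) w hw) γ : ↥(unitaryGroupOfForm (galAdicCompletionMap (L := L) (IsCMField.complexConj L) hw) (placeForm (Matrix.of fun i j : Fin 2 => if i.val + j.val + 1 = 2 then (1 : L) else 0) w.1)))) : GL (Fin 2) (w.1.adicCompletion L)) : Matrix (Fin 2) (Fin 2) (w.1.adicCompletion L))).det) = WithZero.exp (-((2 * N + 1 : ℕ) : ℤ))) :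
    Nat.card (MulAction.fixedBy (((cmDatum L 2 (Matrix.of fun i j : Fin 2 => if i.val + j.val + 1 = 2 then (1 : L) else 0)).Local v) ⧸ C) γ) + Nat.card (MulAction.fixedBy (((cmDatum L 2 (Matrix.of fun i j : Fin 2 => if i.val + j.val + 1 = 2 then (1 : L) else 0)).Local v) ⧸ C') γ) = 2 * ∑ k ∈ range (N + 1), Nat.card (𝓞 ↥(maximalRealSubfield L) ⧸ v.asIdeal) ^ k := by
  have hrel := natCard_fixedBy_add_eq_natCard_fixedBy_add_one_of_not_exists_isRoot L v w hw hunr ϖ hσϖ C C' I hC hC' hI γ h2v ht hirr N hN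
  have hE : Nat.card (MulAction.fixedBy (((cmDatum L 2 (Matrix.of fun i j : Fin 2 => if i.val + j.val + 1 = 2 then (1 : L) else 0)).Local v) ⧸ I) γ) =
      Nat.card (MulAction.fixedBy (↥(unitaryGroupOfForm (galAdicCompletionMap (L := L) (IsCMField.complexConj L) hw) (placeForm (Matrix.of fun i j : Fin 2 => if i.val + j.val + 1 = 2 then (1 : L) else 0) w.1)) ⧸ (iwahoriGL 2 (w.1.adicCompletion L)).subgroupOf
        (unitaryGroupOfForm (galAdicCompletionMap (L := L) (IsCMField.complexConj L) hw) (placeForm (Matrix.of fun i j : Fin 2 => if i.val + j.val + 1 = 2 then (1 : L) else 0) w.1))) ((localNonsplitEquiv (IsCMField.complexConj L) (Matrix.of fun i j : Fin 2 => if i.val + j.val + 1 = 2 then (1 : L) else 0) (IsCMField.complexConj_ne_one L) w hw) γ)) :=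
    natCard_fixedBy_quotient_congr I _ (localNonsplitEquiv (IsCMField.complexConj L) (Matrix.of fun i j : Fin 2 => if i.val + j.val + 1 = 2 then (1 : L) else 0) (IsCMField.complexConj_ne_one L) w hw).toMulEquiv (fun g => (hI g).trans Subgroup.mem_subgroupOf.symm) γ
  have hEsum := natCard_fixedBy_iwahori_add_one_eq_two_mul_sum_of_not_exists_isRoot L v w hw hunr ((localNonsplitEquiv (IsCMField.complexConj L) (Matrix.of fun i j : Fin 2 => if i.val + j.val + 1 = 2 then (1 : L) else 0) (IsCMField.complexConj_ne_one L) w hw) γ) h2v ht hirr N hN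
  omega

end CM

end Summit.HodgeConjecture.HodgeConjecture.Cruxes.H413.K2E3RankOneEllipticFixedPointCountQuadratic

end
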